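import Mathlib
import Summits.CriticalPhenomena.PercolationContinuityZ3.Theses.PercNearOneGluing
import Summits.CriticalPhenomena.PercolationContinuityZ3.Theorems.PercNearOneGluingNearOneGluingPocketLaplace
import Summits.CriticalPhenomena.PercolationContinuityZ3.Theorems.PercNearOneGluingNearOneGluingNoAttachAll
import Summits.CriticalPhenomena.PercolationContinuityZ3.Theorems.PercNearOneGluingNearOneGluingFiniteJensen
import HarnessLib

/-!
# Crux `PercNearOneGluing.NearOneGluing` (stmt-CriticalPhenomena-4574), line `SketchR2I5` (finger–Laplace) —
# deliverables: the `|A|`-free LIVE-FRACTION bounds and the reduction of the crux to live-fraction rarity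

Lead prover-line-stmt-CriticalPhenomena-4574-c1-0, 2026-08-16.  Composed from the three landed stubs of the line
(`stub_pocketLaplace` p98332, `stub_noAttachAll` p98239, `stub_finiteJensen` p97920).  Lands with
`--supports stmt-CriticalPhenomena-4574`.

Setting: one finite weighted graph — vertices `Fin n`, weights `w`, `μ = prodBernoulli w` on bond configurations
`ω : Set (Sym2 (Fin n))`; relay set `A`, source `o ∉ A`, target `b`; `P ω` the relay-free pocket of `o` (any
selector with `v ∈ P ω ↔ o ↔ v inside (↑A)ᶜ`); for a vertex set `T` and a relay `a`,
`q_a(T) = ∏_{x ∈ T} (1 - w s(x,a))` (`a` NOT attached to `T`), `allProd(T) = ∏_{a ∈ A} q_a(T) = e^{-Λ(T)}`,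
`liveProd(T, ω) = ∏_{a ∈ A, a ↔ b off T} q_a(T) = e^{-Λ_live(T, ω)}`.

* `liveFraction_jensen` (**relative form**, `|A|`-free): for `0 < c ≤ 1`,
  `μ{o ↮ b ∧ liveProd(P ω, ω) ≤ allProd(P ω)^c} ≤ μ(o ↮ A)^c` — bad configurations in which at least a
  `c`-fraction of the pocket's relay-attachment weight is live cost `δ^c`, with no entropy factor (the pocket law
  is a probability distribution; finite Jensen).
* `liveFraction_tail` (**absolute form**, hypothesis-free): for `0 ≤ τ`,
  `μ{o ↮ b ∧ liveProd(P ω, ω) ≤ τ} ≤ τ` — the conditional probability of `o ↮ b` given the pocket and the outside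
  world is at most `liveProd = e^{-Λ_live}`.
* `nearOneGluing_iff_liveFractionRare`: the crux is EQUIVALENT to the rarity, under its hypotheses, of the bad
  configurations with `allProd^c < liveProd` (`Λ_live < c·Λ`) for some / every `c ∈ (0,1)` — the registered residual
  `stub_liveFractionRare` of the line.  (`⇐` is the line's composition; `⇒` because that event lies in `{o ↮ b}`.)
-/

namespace Summit.CriticalPhenomena.PercolationContinuityZ3.Theorems

open scoped BigOperators Classical
open MeasureTheory Set
open Literature.Probability.LatticeModels (prodBernoulli)
open Literature.Probability.Percolation (openConn openConnIn DeterminedBy determinedBy_iff)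

section LiveFraction

variable {n : ℕ}

/-- If `b` lies in the relay-free pocket then `o ↔ b`. -/
theorem liveFraction_openConn_of_mem_openConnIn {A : Finset (Fin n)} {o b : Fin n} {ω : Set (Sym2 (Fin n))}
    (h : ω ∈ openConnIn ((↑A : Set (Fin n))ᶜ) o b) : ω ∈ openConn o b := by
  obtain ⟨_, _, hr⟩ := h
  exact hr.map (SimpleGraph.Embedding.induce _).toHom

/-- **Generic pocket-sum bound.** For a family of thresholds `τ T ≥ 0` (one per pocket value):
`μ{o ↮ b ∧ liveProd(P ω, ω) ≤ τ (P ω)} ≤ Σ_T μ{P = T} · τ T`.  (Stub 1 with the outside event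
`D_T = {liveProd(T, ·) ≤ τ T}`, summed over the partition by the pocket value.) -/
theorem liveFraction_sum_bound (w : Sym2 (Fin n) → unitInterval) (A : Finset (Fin n)) (o b : Fin n)
    (ho : o ∉ A) (P : Set (Sym2 (Fin n)) → Finset (Fin n))
    (hP : ∀ ω v, v ∈ P ω ↔ ω ∈ openConnIn ((↑A : Set (Fin n))ᶜ) o v)
    (τ : Finset (Fin n) → ℝ) (hτ : ∀ T, 0 ≤ τ T) :
    (prodBernoulli w).real {ω | ω ∉ openConn o b ∧
        ∏ a ∈ A.filter (fun a => ω ∈ openConnIn ((↑(P ω) : Set (Fin n))ᶜ) a b),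
            ∏ x ∈ P ω, (1 - (w s(x, a) : ℝ)) ≤ τ (P ω)} ≤
      ∑ T : Finset (Fin n), (prodBernoulli w).real {ω | P ω = T} * τ T := by
  let μ := prodBernoulli w
  let liveP : Finset (Fin n) → Set (Sym2 (Fin n)) → ℝ := fun T ω =>
    ∏ a ∈ A.filter (fun a => ω ∈ openConnIn ((↑T : Set (Fin n))ᶜ) a b), ∏ x ∈ T, (1 - (w s(x, a) : ℝ))
  let E : Set (Set (Sym2 (Fin n))) := {ω | ω ∉ openConn o b ∧ liveP (P ω) ω ≤ τ (P ω)}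
  let D : Finset (Fin n) → Set (Set (Sym2 (Fin n))) := fun T => {ω | liveP T ω ≤ τ T}
  change μ.real E ≤ ∑ T : Finset (Fin n), μ.real {ω | P ω = T} * τ T
  have hliveP_nn : ∀ T ω, 0 ≤ liveP T ω := fun T ω => pocketLaplace_prod_prod_nonneg w _ T
  have hpiece : ∀ T : Finset (Fin n), μ.real (E ∩ {ω | P ω = T}) ≤ μ.real {ω | P ω = T} * τ T := by
    intro T
    by_cases hbT : b ∈ T
    · have hempty : E ∩ {ω | P ω = T} = ∅ := by
        ext ω
        simp only [Set.mem_inter_iff, Set.mem_setOf_eq, Set.mem_empty_iff_false, iff_false, not_and]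
        intro hω hPT
        have hb : b ∈ P ω := hPT ▸ hbT
        exact hω.1 (liveFraction_openConn_of_mem_openConnIn ((hP ω b).1 hb))
      rw [hempty, measureReal_empty]
      exact mul_nonneg measureReal_nonneg (hτ T)
    · have hD : DeterminedBy (D T) {e | ∀ x ∈ T, x ∉ e} := by
        rw [determinedBy_iff]
        intro ω ω' h
        change (liveP T ω ≤ τ T) ↔ (liveP T ω' ≤ τ T)
        have hf := pocketLaplace_liveFilter_eq_of_inter_eq A T b h
        change (∏ a ∈ A.filter (fun a => ω ∈ openConnIn ((↑T : Set (Fin n))ᶜ) a b),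
            ∏ x ∈ T, (1 - (w s(x, a) : ℝ))) ≤ τ T ↔
          (∏ a ∈ A.filter (fun a => ω' ∈ openConnIn ((↑T : Set (Fin n))ᶜ) a b),
            ∏ x ∈ T, (1 - (w s(x, a) : ℝ))) ≤ τ T
        rw [hf]
      have h1 := stub_pocketLaplace n w A o b ho P hP T hbT (D T) hD
      have hsub : E ∩ {ω | P ω = T} ⊆ {ω | ω ∉ openConn o b ∧ P ω = T} ∩ D T := by
        rintro ω ⟨⟨hob, hle⟩, hPT⟩
        have hPT' : P ω = T := hPT
        refine ⟨⟨hob, hPT'⟩, ?_⟩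
        change liveP T ω ≤ τ T
        have : liveP (P ω) ω ≤ τ (P ω) := hle
        rw [hPT'] at this
        exact this
      have hint : ∫ ω in D T, liveP T ω ∂μ ≤ τ T := by
        have hmono : ∫ ω in D T, liveP T ω ∂μ ≤ ∫ ω in D T, τ T ∂μ :=
          setIntegral_mono_on Integrable.of_finite.integrableOn Integrable.of_finite.integrableOn
            MeasurableSet.of_discrete fun ω hω => hω
        refine hmono.trans ?_
        rw [setIntegral_const, smul_eq_mul]
        calc μ.real (D T) * τ T ≤ 1 * τ T := mul_le_mul_of_nonneg_right measureReal_le_one (hτ T)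
          _ = τ T := one_mul _
      calc μ.real (E ∩ {ω | P ω = T})
          ≤ μ.real ({ω | ω ∉ openConn o b ∧ P ω = T} ∩ D T) := measureReal_mono hsub (measure_ne_top _ _)
        _ ≤ μ.real {ω | P ω = T} * ∫ ω in D T, liveP T ω ∂μ := h1
        _ ≤ μ.real {ω | P ω = T} * τ T := mul_le_mul_of_nonneg_left hint measureReal_nonneg
  have hcover : E ⊆ ⋃ T ∈ (Finset.univ : Finset (Finset (Fin n))), (E ∩ {ω | P ω = T}) := by
    intro ω hω
    simp only [Set.mem_iUnion, exists_prop]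
    exact ⟨P ω, Finset.mem_univ _, hω, rfl⟩
  calc μ.real E ≤ ∑ T : Finset (Fin n), μ.real (E ∩ {ω | P ω = T}) :=
        (measureReal_mono hcover (measure_ne_top _ _)).trans (measureReal_biUnion_finset_le _ _)
    _ ≤ ∑ T : Finset (Fin n), μ.real {ω | P ω = T} * τ T := Finset.sum_le_sum fun T _ => hpiece T

/-- The pocket values partition: `Σ_T μ{P = T} ≤ 1` (in fact `= 1`). -/
theorem liveFraction_sum_pocket_le_one (w : Sym2 (Fin n) → unitInterval)
    (P : Set (Sym2 (Fin n)) → Finset (Fin n)) :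
    ∑ T : Finset (Fin n), (prodBernoulli w).real {ω | P ω = T} ≤ 1 := by
  have h := sum_measureReal_preimage_singleton (μ := prodBernoulli w) (f := P)
    (Finset.univ : Finset (Finset (Fin n))) (fun _ _ => MeasurableSet.of_discrete)
  rw [Finset.coe_univ, Set.preimage_univ, probReal_univ] at h
  calc ∑ T : Finset (Fin n), (prodBernoulli w).real {ω | P ω = T}
      = ∑ T : Finset (Fin n), (prodBernoulli w).real (P ⁻¹' {T}) := rfl
    _ ≤ 1 := h.le

/-- **Live-fraction bound, relative form (`|A|`-free).** For the relay-free pocket selector `P`, `o ∉ A` and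
`0 < c ≤ 1`: `μ{o ↮ b ∧ liveProd(P ω, ω) ≤ allProd(P ω)^c} ≤ μ(o ↮ A)^c`.  Bad configurations whose pocket
keeps at least a `c`-fraction of its relay-attachment weight live (`Λ_live ≥ c·Λ`) cost `δ^c`; no entropy. -/
theorem liveFraction_jensen (w : Sym2 (Fin n) → unitInterval) (A : Finset (Fin n)) (o b : Fin n)
    (ho : o ∉ A) (P : Set (Sym2 (Fin n)) → Finset (Fin n))
    (hP : ∀ ω v, v ∈ P ω ↔ ω ∈ openConnIn ((↑A : Set (Fin n))ᶜ) o v)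
    (c : ℝ) (hc0 : 0 < c) (hc1 : c ≤ 1) :
    (prodBernoulli w).real {ω | ω ∉ openConn o b ∧
        ∏ a ∈ A.filter (fun a => ω ∈ openConnIn ((↑(P ω) : Set (Fin n))ᶜ) a b),
            ∏ x ∈ P ω, (1 - (w s(x, a) : ℝ)) ≤
          (∏ a ∈ A, ∏ x ∈ P ω, (1 - (w s(x, a) : ℝ))) ^ c} ≤
      ((prodBernoulli w).real (⋃ a ∈ A, openConn o a)ᶜ) ^ c := by
  let allP : Finset (Fin n) → ℝ := fun T => ∏ a ∈ A, ∏ x ∈ T, (1 - (w s(x, a) : ℝ))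
  have hallP_nn : ∀ T, 0 ≤ allP T := fun T => pocketLaplace_prod_prod_nonneg w A T
  have h := liveFraction_sum_bound w A o b ho P hP (fun T => (allP T) ^ c)
    (fun T => Real.rpow_nonneg (hallP_nn T) c)
  refine h.trans ?_
  calc ∑ T : Finset (Fin n), (prodBernoulli w).real {ω | P ω = T} * (allP T) ^ c
      ≤ (∑ T : Finset (Fin n), (prodBernoulli w).real {ω | P ω = T} * allP T) ^ c :=
        stub_finiteJensen Finset.univ (fun T => (prodBernoulli w).real {ω | P ω = T}) allP c hc0 hc1
          (fun T _ => measureReal_nonneg) (liveFraction_sum_pocket_le_one w P) (fun T _ => hallP_nn T)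
    _ ≤ ((prodBernoulli w).real (⋃ a ∈ A, openConn o a)ᶜ) ^ c :=
        Real.rpow_le_rpow (Finset.sum_nonneg fun T _ => mul_nonneg measureReal_nonneg (hallP_nn T))
          (stub_noAttachAll n w A o ho P hP) hc0.le

/-- **Live-fraction bound, absolute form (hypothesis-free).** For the relay-free pocket selector `P`, `o ∉ A`
and `0 ≤ τ`: `μ{o ↮ b ∧ liveProd(P ω, ω) ≤ τ} ≤ τ` — given the pocket and the outside world, `o ↮ b` has
conditional probability at most `liveProd = e^{-Λ_live}`, so configurations with `Λ_live ≥ log(1/τ)` carry bad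
mass `≤ τ`.  Consequently only `Λ_live = O(1)` matters for the crux. -/
theorem liveFraction_tail (w : Sym2 (Fin n) → unitInterval) (A : Finset (Fin n)) (o b : Fin n)
    (ho : o ∉ A) (P : Set (Sym2 (Fin n)) → Finset (Fin n))
    (hP : ∀ ω v, v ∈ P ω ↔ ω ∈ openConnIn ((↑A : Set (Fin n))ᶜ) o v)
    (τ : ℝ) (hτ : 0 ≤ τ) :
    (prodBernoulli w).real {ω | ω ∉ openConn o b ∧
        ∏ a ∈ A.filter (fun a => ω ∈ openConnIn ((↑(P ω) : Set (Fin n))ᶜ) a b),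
            ∏ x ∈ P ω, (1 - (w s(x, a) : ℝ)) ≤ τ} ≤ τ := by
  have h := liveFraction_sum_bound w A o b ho P hP (fun _ => τ) (fun _ => hτ)
  refine h.trans ?_
  rw [← Finset.sum_mul]
  calc (∑ T : Finset (Fin n), (prodBernoulli w).real {ω | P ω = T}) * τ ≤ 1 * τ :=
        mul_le_mul_of_nonneg_right (liveFraction_sum_pocket_le_one w P) hτ
    _ = τ := one_mul τ

end LiveFraction

/-- **The crux is equivalent to live-fraction rarity** (the line's registered residual `stub_liveFractionRare`,
quantified over `c ∈ (0,1)`): `NearOneGluing ↔ ∀ ε > 0, ∀ c ∈ (0,1), ∃ δ > 0`, on every instance with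
`μ(o ↮ A) ≤ δ`, `μ(a ↮ b) ≤ δ` (`a ∈ A`), `o ∉ A`, `o ≠ b`, the bad configurations with
`allProd(P ω)^c < liveProd(P ω, ω)` have mass `≤ ε`.  `→`: that event lies in `{o ↮ b}`; `←`: the line's
composition `μ(o ↮ b) ≤ μ(o ↮ A) + μ({o ↮ b} ∧ liveProd ≤ allProd^{1/2}) + residual < δ + √δ + ε/3`. -/
theorem nearOneGluing_iff_liveFractionRare : Summit.CriticalPhenomena.PercolationContinuityZ3.Theses.PercNearOneGluing.NearOneGluing ↔ (∀ ε : ℝ, 0 < ε → ∀ c : ℝ, 0 < c → c < 1 → ∃ δ : ℝ, 0 < δ ∧ ∀ (n : ℕ) (w : Sym2 (Fin n) → unitInterval) (A : Finset (Fin n)) (o b : Fin n), o ∉ A → o ≠ b → (Literature.Probability.LatticeModels.prodBernoulli w).real (⋃ a ∈ A, Literature.Probability.Percolation.openConn o a)ᶜ ≤ δ → (∀ a ∈ A, (Literature.Probability.LatticeModels.prodBernoulli w).real (Literature.Probability.Percolation.openConn a b)ᶜ ≤ δ) → ∀ (P : Set (Sym2 (Fin n)) → Finset (Fin n)), (∀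 ω v, v ∈ P ω ↔ ω ∈ Literature.Probability.Percolation.openConnIn ((↑A : Set (Fin n))ᶜ) o v) → (Literature.Probability.LatticeModels.prodBernoulli w).real {ω | ω ∉ Literature.Probability.Percolation.openConn o b ∧ (∃ a ∈ A, ω ∈ Literature.Probability.Percolation.openConn o a) ∧ (∏ a ∈ A, ∏ x ∈ P ω, (1 - (w s(x, a) : ℝ))) ^ c < ∏ a ∈ A.filter (fun a => ω ∈ Literature.Probability.Percolation.openConnIn ((↑(P ω) : Set (Fin n))ᶜ) a b), ∏ x ∈ P ω, (1 - (w s(x, a) : ℝ))} ≤ ε) := by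
  constructor
  · -- `→`: the residual event lies in `{o ↮ b}`
    intro hX ε hε _ _ _
    obtain ⟨δ, hδ, h⟩ := hX ε hε
    refine ⟨δ / 2, by positivity, ?_⟩
    intro n w A o b _ _ hoA hab P _
    have hoA' : 1 - δ < (prodBernoulli w).real (⋃ a ∈ A, openConn o a) := by
      have := probReal_compl_eq_one_sub (μ := prodBernoulli w) (s := ⋃ a ∈ A, openConn o a)
        MeasurableSet.of_discrete
      linarith
    have hab' : ∀ a ∈ A, 1 - δ < (prodBernoulli w).real (openConn a b) := by
      intro a ha
      have h1 := hab a ha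
      have := probReal_compl_eq_one_sub (μ := prodBernoulli w) (s := openConn a b) MeasurableSet.of_discrete
      linarith
    have hconc := h n w A o b hoA' hab'
    have hcompl : (prodBernoulli w).real (openConn o b)ᶜ < ε := by
      rw [probReal_compl_eq_one_sub MeasurableSet.of_discrete]; linarith
    refine le_of_lt (lt_of_le_of_lt (measureReal_mono ?_ (measure_ne_top _ _)) hcompl)
    intro ω hω
    exact hω.1
  · -- `←`: the line's composition
    intro hres ε hε
    obtain ⟨δ₄, hδ₄, h4⟩ := hres (ε / 3) (by positivity) (1 / 2) (by norm_num) (by norm_num)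
    refine ⟨min δ₄ (min ((ε / 3) ^ 2) (ε / 3)), lt_min hδ₄ (lt_min (by positivity) (by positivity)), ?_⟩
    intro n w A o b hoA hab
    set δ := min δ₄ (min ((ε / 3) ^ 2) (ε / 3)) with hδdef
    have hδ₄' : δ ≤ δ₄ := min_le_left _ _
    have hδsq : δ ≤ (ε / 3) ^ 2 := (min_le_right _ _).trans (min_le_left _ _)
    have hδε : δ ≤ ε / 3 := (min_le_right _ _).trans (min_le_right _ _)
    let μ := prodBernoulli w
    change 1 - ε < μ.real (openConn o b)
    by_cases hob : o = b
    · subst hob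
      have : (openConn o o : Set (Set (Sym2 (Fin n)))) = Set.univ :=
        Set.eq_univ_of_forall fun ω => SimpleGraph.Reachable.refl _
      rw [this, probReal_univ]
      linarith
    by_cases ho : o ∈ A
    · have := hab o ho
      change 1 - δ < μ.real (openConn o b) at this
      linarith
    have hcomplA : μ.real (⋃ a ∈ A, openConn o a)ᶜ < δ := by
      rw [probReal_compl_eq_one_sub MeasurableSet.of_discrete]
      change 1 - δ < μ.real (⋃ a ∈ A, openConn o a) at hoA
      linarith
    have hcomplab : ∀ a ∈ A, μ.real (openConn a b)ᶜ ≤ δ₄ := by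
      intro a ha
      rw [probReal_compl_eq_one_sub MeasurableSet.of_discrete]
      have := hab a ha
      change 1 - δ < μ.real (openConn a b) at this
      linarith
    let P : Set (Sym2 (Fin n)) → Finset (Fin n) := fun ω =>
      Finset.univ.filter fun v => ω ∈ openConnIn ((↑A : Set (Fin n))ᶜ) o v
    have hP : ∀ ω v, v ∈ P ω ↔ ω ∈ openConnIn ((↑A : Set (Fin n))ᶜ) o v := fun ω v => by simp [P]
    let allP : Set (Sym2 (Fin n)) → ℝ := fun ω => ∏ a ∈ A, ∏ x ∈ P ω, (1 - (w s(x, a) : ℝ))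
    let liveP : Set (Sym2 (Fin n)) → ℝ := fun ω =>
      ∏ a ∈ A.filter (fun a => ω ∈ openConnIn ((↑(P ω) : Set (Fin n))ᶜ) a b), ∏ x ∈ P ω, (1 - (w s(x, a) : ℝ))
    let Bad : Set (Set (Sym2 (Fin n))) := (openConn o b)ᶜ
    let NoA : Set (Set (Sym2 (Fin n))) := (⋃ a ∈ A, openConn o a)ᶜ
    let J : Set (Set (Sym2 (Fin n))) := {ω | ω ∉ openConn o b ∧ liveP ω ≤ (allP ω) ^ (1 / 2 : ℝ)}
    let R : Set (Set (Sym2 (Fin n))) := {ω | ω ∉ openConn o b ∧ (∃ a ∈ A, ω ∈ openConn o a) ∧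
        (allP ω) ^ (1 / 2 : ℝ) < liveP ω}
    have hcover : Bad ⊆ NoA ∪ (J ∪ R) := by
      intro ω hω
      have hω' : ω ∉ openConn o b := hω
      by_cases hA : ω ∈ (⋃ a ∈ A, openConn o a)
      · right
        by_cases hle : liveP ω ≤ (allP ω) ^ (1 / 2 : ℝ)
        · left; exact ⟨hω', hle⟩
        · right
          refine ⟨hω', ?_, lt_of_not_ge hle⟩
          simpa only [Set.mem_iUnion, exists_prop] using hA
      · left; exact hA
    have hJ : μ.real J ≤ (μ.real NoA) ^ (1 / 2 : ℝ) :=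
      liveFraction_jensen w A o b ho P hP (1 / 2) (by norm_num) (by norm_num)
    have hJ' : μ.real J ≤ ε / 3 := by
      refine hJ.trans ?_
      have h1 : (μ.real NoA) ^ (1 / 2 : ℝ) ≤ ((ε / 3) ^ 2) ^ (1 / 2 : ℝ) :=
        Real.rpow_le_rpow measureReal_nonneg (hcomplA.le.trans hδsq) (by norm_num)
      have h2 : ((ε / 3) ^ 2) ^ (1 / 2 : ℝ) = ε / 3 := by
        rw [← Real.sqrt_eq_rpow, Real.sqrt_sq (by positivity)]
      linarith
    have hR : μ.real R ≤ ε / 3 :=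
      h4 n w A o b ho hob (hcomplA.le.trans hδ₄') hcomplab P hP
    have hBad : μ.real Bad < ε := by
      calc μ.real Bad ≤ μ.real (NoA ∪ (J ∪ R)) := measureReal_mono hcover (measure_ne_top _ _)
        _ ≤ μ.real NoA + μ.real (J ∪ R) := measureReal_union_le _ _
        _ ≤ μ.real NoA + (μ.real J + μ.real R) := by
            have := measureReal_union_le (μ := μ) J R
            linarith
        _ < δ + (ε / 3 + ε / 3) := by linarith
        _ ≤ ε := by linarith
    have hfin : μ.real (openConn o b) = 1 - μ.real Bad := by
      have := probReal_compl_eq_one_sub (μ := μ) (s := openConn o b) MeasurableSet.of_discrete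
      change μ.real Bad = 1 - μ.real (openConn o b) at this
      linarith
    rw [hfin]
    linarith

end Summit.CriticalPhenomena.PercolationContinuityZ3.Theorems
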